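import Mathlib
import HarnessLib
import Summits.AnomalousDissipation.AnomalousDissipation.Theses.PointSink

/-!
# Split glue for crux `PointSink.ConeDesingularisation` (stmt-AnomalousDissipation-19034)
# `coneDesingularisation_of_subs : SuctionFeederCone → FedDesingularisation → ConeDesingularisation`

Strategist decomposition (planner-cstrat-stmt-AnomalousDissipation-19034-s1-0, 2026-08-17) of the rank-3 crux
of route `PointSink` into two children, filed by `ledger route edit --split ConeDesingularisation --into …
--glue-by Summit.AnomalousDissipation.AnomalousDissipation.Theorems.coneDesingularisation_of_subs`:

* `SuctionFeederCone` (crux; Euler side): a discretely self-similar (degrees `(−2/3, −4/3)`) weak stationary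
  Euler pair `(V, P)` off the origin of `ℝ³` — every clause of the closed crux `PointFluxCone` — that is
  moreover locally `L³ / L^{3/2}` off the origin, satisfies the LOCAL ENERGY BALANCE off the origin
  (`∫ (½|V|²+P)⟪V,∇η⟫ = 0` for tests `η` supported off `0`: no Duchon–Robert defect on `ℝ³ ∖ {0}`, so the
  shell log-moment equals `Π log λ` with `Π` the energy flux through every sphere), is a SUCTION cone
  (`½|V|² + P ≤ 0` a.e.; head bounded below on the fundamental shell) and has inward flux (log-moment `< 0`).
* `FedDesingularisation` (crux; NS side): such a cone implies the support node `CascadeSoliton` verbatim.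

WHY. `PointFluxCone` is now a theorem (`Theorems.PointFluxCone_of`, wild box) whose witness carries no
inter-shell energy flux and has positive head, so the crux as typed is equivalent to `CascadeSoliton` and
its hypothesis is spent; the split re-erects the route's Euler gate with the admissibility clauses that the
far field of any cascade soliton must satisfy (weak Euler: `Theorems.stub_farFieldWeakEuler`; suction:
head maximum principle `Δ(½|Q|²+P) − Q·∇(½|Q|²+P) = |curl Q|² ≥ 0` + decay of D-solutions, Chae–Wolf
arXiv:1604.07643 §1 / Galdi X.5.1) and that make the energy bookkeeping of the desingularisation exact
(`D(Q) = |Π|`). The glue is modus ponens: the (proved) hypothesis `PointFluxCone` is discarded and the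
conclusion of the crux is `CascadeSoliton`'s body verbatim. Statements are spelled out notation-free,
verbatim the children filed on the route. Pure proof file (no definitions). [folklore]
-/

noncomputable section

-- `Summit.<Summit>.<Problem>`: single-conjunct summit, the duplicate namespace is mandated (CONVENTIONS §2).
set_option linter.dupNamespace false

namespace Summit.AnomalousDissipation.AnomalousDissipation.Theorems

/-- **Split glue** `SuctionFeederCone → FedDesingularisation → ConeDesingularisation` for the strategist
decomposition of crux stmt-AnomalousDissipation-19034 (children spelled out verbatim; the second child is
the implication from the first child's statement to `PointSink.CascadeSoliton`'s body, which is the crux's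
conclusion verbatim). Modus ponens, discarding the crux's proved hypothesis `PointFluxCone`. [folklore] -/
theorem coneDesingularisation_of_subs :
    (∃ (lam : ℝ) (V : EuclideanSpace ℝ (Fin 3) → EuclideanSpace ℝ (Fin 3)) (P : EuclideanSpace ℝ
      (Fin 3) → ℝ), 1 < lam ∧ MeasureTheory.AEStronglyMeasurable V MeasureTheory.volume ∧ (∀ x :
      EuclideanSpace ℝ (Fin 3), x ≠ 0 → V (lam • x) = lam ^ (-(2 / 3 : ℝ)) • V x) ∧ (∀ x :
      EuclideanSpace ℝ (Fin 3), x ≠ 0 → P (lam • x) = lam ^ (-(4 / 3 : ℝ)) * P x) ∧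
      MeasureTheory.LocallyIntegrableOn (fun x => ‖V x‖ ^ 2) {x : EuclideanSpace ℝ (Fin 3) | x ≠ 0}
      MeasureTheory.volume ∧ MeasureTheory.LocallyIntegrableOn P {x : EuclideanSpace ℝ (Fin 3) | x ≠
      0} MeasureTheory.volume ∧ MeasureTheory.LocallyIntegrableOn (fun x => ‖V x‖ ^ 3) {x :
      EuclideanSpace ℝ (Fin 3) | x ≠ 0} MeasureTheory.volume ∧ MeasureTheory.LocallyIntegrableOn
      (fun x => |P x| ^ (3 / 2 : ℝ)) {x : EuclideanSpace ℝ (Fin 3) | x ≠ 0} MeasureTheory.volume ∧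
      (∀ φ : EuclideanSpace ℝ (Fin 3) → EuclideanSpace ℝ (Fin 3),
      Literature.Analysis.FunctionSpaces.IsTestFunctionOn ⟨{x : EuclideanSpace ℝ (Fin 3) | x ≠ 0},
      isOpen_ne⟩ φ → ∫ x, (inner ℝ (V x) (fderiv ℝ φ x (V x)) + P x *
      Literature.Analysis.FluidPDE.VectorCalculus.divergence φ x) = 0) ∧ (∀ θ : EuclideanSpace ℝ
      (Fin 3) → ℝ, Literature.Analysis.FunctionSpaces.IsTestFunctionOn ⟨{x : EuclideanSpace ℝ (Fin
      3) | x ≠ 0}, isOpen_ne⟩ θ → ∫ x, inner ℝ (V x) (gradient θ x) = 0) ∧ (∀ η : EuclideanSpace ℝ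
      (Fin 3) → ℝ, Literature.Analysis.FunctionSpaces.IsTestFunctionOn ⟨{x : EuclideanSpace ℝ (Fin
      3) | x ≠ 0}, isOpen_ne⟩ η → ∫ x, (‖V x‖ ^ 2 / 2 + P x) * inner ℝ (V x) (gradient η x) = 0) ∧
      (∀ᵐ x ∂MeasureTheory.volume, ‖V x‖ ^ 2 / 2 + P x ≤ 0) ∧ (∃ M : ℝ, ∀ᵐ x
      ∂(MeasureTheory.volume.restrict {x : EuclideanSpace ℝ (Fin 3) | 1 < ‖x‖ ∧ ‖x‖ < lam}), -M ≤ ‖V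
      x‖ ^ 2 / 2 + P x) ∧ MeasureTheory.IntegrableOn (fun x => (‖V x‖ ^ 2 / 2 + P x) * (inner ℝ (V
      x) x / ‖x‖ ^ 2)) {x : EuclideanSpace ℝ (Fin 3) | 1 < ‖x‖ ∧ ‖x‖ < lam} MeasureTheory.volume ∧
      (∫ x in {x : EuclideanSpace ℝ (Fin 3) | 1 < ‖x‖ ∧ ‖x‖ < lam}, (‖V x‖ ^ 2 / 2 + P x) * (inner ℝ
      (V x) x / ‖x‖ ^ 2)) < 0) →
    ((∃ (lam : ℝ) (V : EuclideanSpace ℝ (Fin 3) → EuclideanSpace ℝ (Fin 3)) (P : EuclideanSpace ℝ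
      (Fin 3) → ℝ), 1 < lam ∧ MeasureTheory.AEStronglyMeasurable V MeasureTheory.volume ∧ (∀ x :
      EuclideanSpace ℝ (Fin 3), x ≠ 0 → V (lam • x) = lam ^ (-(2 / 3 : ℝ)) • V x) ∧ (∀ x :
      EuclideanSpace ℝ (Fin 3), x ≠ 0 → P (lam • x) = lam ^ (-(4 / 3 : ℝ)) * P x) ∧
      MeasureTheory.LocallyIntegrableOn (fun x => ‖V x‖ ^ 2) {x : EuclideanSpace ℝ (Fin 3) | x ≠ 0}
      MeasureTheory.volume ∧ MeasureTheory.LocallyIntegrableOn P {x : EuclideanSpace ℝ (Fin 3) | x ≠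
      0} MeasureTheory.volume ∧ MeasureTheory.LocallyIntegrableOn (fun x => ‖V x‖ ^ 3) {x :
      EuclideanSpace ℝ (Fin 3) | x ≠ 0} MeasureTheory.volume ∧ MeasureTheory.LocallyIntegrableOn
      (fun x => |P x| ^ (3 / 2 : ℝ)) {x : EuclideanSpace ℝ (Fin 3) | x ≠ 0} MeasureTheory.volume ∧
      (∀ φ : EuclideanSpace ℝ (Fin 3) → EuclideanSpace ℝ (Fin 3),
      Literature.Analysis.FunctionSpaces.IsTestFunctionOn ⟨{x : EuclideanSpace ℝ (Fin 3) | x ≠ 0},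
      isOpen_ne⟩ φ → ∫ x, (inner ℝ (V x) (fderiv ℝ φ x (V x)) + P x *
      Literature.Analysis.FluidPDE.VectorCalculus.divergence φ x) = 0) ∧ (∀ θ : EuclideanSpace ℝ
      (Fin 3) → ℝ, Literature.Analysis.FunctionSpaces.IsTestFunctionOn ⟨{x : EuclideanSpace ℝ (Fin
      3) | x ≠ 0}, isOpen_ne⟩ θ → ∫ x, inner ℝ (V x) (gradient θ x) = 0) ∧ (∀ η : EuclideanSpace ℝ
      (Fin 3) → ℝ, Literature.Analysis.FunctionSpaces.IsTestFunctionOn ⟨{x : EuclideanSpace ℝ (Fin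
      3) | x ≠ 0}, isOpen_ne⟩ η → ∫ x, (‖V x‖ ^ 2 / 2 + P x) * inner ℝ (V x) (gradient η x) = 0) ∧
      (∀ᵐ x ∂MeasureTheory.volume, ‖V x‖ ^ 2 / 2 + P x ≤ 0) ∧ (∃ M : ℝ, ∀ᵐ x
      ∂(MeasureTheory.volume.restrict {x : EuclideanSpace ℝ (Fin 3) | 1 < ‖x‖ ∧ ‖x‖ < lam}), -M ≤ ‖V
      x‖ ^ 2 / 2 + P x) ∧ MeasureTheory.IntegrableOn (fun x => (‖V x‖ ^ 2 / 2 + P x) * (inner ℝ (V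
      x) x / ‖x‖ ^ 2)) {x : EuclideanSpace ℝ (Fin 3) | 1 < ‖x‖ ∧ ‖x‖ < lam} MeasureTheory.volume ∧
      (∫ x in {x : EuclideanSpace ℝ (Fin 3) | 1 < ‖x‖ ∧ ‖x‖ < lam}, (‖V x‖ ^ 2 / 2 + P x) * (inner ℝ
      (V x) x / ‖x‖ ^ 2)) < 0) → ∃ (Q : EuclideanSpace ℝ (Fin 3) → EuclideanSpace ℝ (Fin 3)) (P :
      EuclideanSpace ℝ (Fin 3) → ℝ), Literature.Analysis.FluidPDE.IsClassicalNSSolutionOn Set.univ 1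
      (fun _ _ => 0) (fun _ => Q) (fun _ => P) ∧ (∃ C : ℝ, ∀ R : ℝ, 1 ≤ R → ∫ x in Metric.ball (0 :
      EuclideanSpace ℝ (Fin 3)) R, ‖Q x‖ ^ 2 ≤ C * R ^ (5 / 3 : ℝ)) ∧ MeasureTheory.Integrable (fun
      x => Literature.Analysis.FluidPDE.frobeniusNormSq (fderiv ℝ Q x)) ∧ 0 < ∫ x,
      Literature.Analysis.FluidPDE.frobeniusNormSq (fderiv ℝ Q x) ∧ ∃ (lam : ℝ) (V : EuclideanSpace
      ℝ (Fin 3) → EuclideanSpace ℝ (Fin 3)), 1 < lam ∧ MeasureTheory.AEStronglyMeasurable V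
      MeasureTheory.volume ∧ (∀ x : EuclideanSpace ℝ (Fin 3), x ≠ 0 → V (lam • x) = lam ^ (-(2 / 3 :
      ℝ)) • V x) ∧ MeasureTheory.LocallyIntegrableOn (fun x => ‖V x‖ ^ 2) {x : EuclideanSpace ℝ (Fin
      3) | x ≠ 0} MeasureTheory.volume ∧ 0 < ∫ x in {x : EuclideanSpace ℝ (Fin 3) | 1 < ‖x‖ ∧ ‖x‖ <
      lam}, ‖V x‖ ^ 2 ∧ Filter.Tendsto (fun k : ℕ => (lam ^ k) ^ (-(5 / 3 : ℝ)) * ∫ x in {x :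
      EuclideanSpace ℝ (Fin 3) | lam ^ k < ‖x‖ ∧ ‖x‖ < lam ^ (k + 1)}, ‖Q x - V x‖ ^ 2) Filter.atTop
      (nhds 0)) →
    Summit.AnomalousDissipation.AnomalousDissipation.Theses.PointSink.ConeDesingularisation :=
  fun h₁ h₂ _ => h₂ h₁

/-- **The feeder class refines the closed cone class** (registered stub `stub_suctionFeederCone_pointFluxCone`
of crux stmt-AnomalousDissipation-19034): a suction feeder cone is in particular a point-flux cone in the
sense of the closed rank-2 crux `PointSink.PointFluxCone` — drop the admissibility clauses and weaken the
inward flux `< 0` to `≠ 0`. So the split STRENGTHENS the route's intended chain `cone → soliton` at its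
Euler end; it does not change its shape. [folklore] -/
theorem stub_suctionFeederCone_pointFluxCone : (∃ (lam : ℝ) (V : EuclideanSpace ℝ (Fin 3) → EuclideanSpace ℝ (Fin 3)) (P : EuclideanSpace ℝ (Fin 3) → ℝ), 1 < lam ∧ MeasureTheory.AEStronglyMeasurable V MeasureTheory.volume ∧ (∀ x : EuclideanSpace ℝ (Fin 3), x ≠ 0 → V (lam • x) = lam ^ (-(2 / 3 : ℝ)) • V x) ∧ (∀ x : EuclideanSpace ℝ (Fin 3), x ≠ 0 → P (lam • x) = lam ^ (-(4 / 3 : ℝ)) * P x) ∧ MeasureTheory.LocallyIntegrableOn (fun x => ‖V x‖ ^ 2) {x : EuclideanSpace ℝ (Fin 3) | x ≠ 0} MeasureTheory.volume ∧ MeasureTheory.LocallyIntegrableOn P {x : EuclideanSpace ℝ (Fin 3) | x ≠ 0} MeasureTheory.volume ∧ MeasureTheory.LocallyIntegrableOn (fun x => ‖V x‖ ^ 3) {x : EuclideanSpace ℝ (Fin 3) | x ≠ 0} MeasureTheory.volume ∧ MeasureTheory.LocallyIntegrableOn (fun x => |P x| ^ (3 / 2 : ℝ)) {x : EuclideanSpace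 ℝ (Fin 3) | x ≠ 0} MeasureTheory.volume ∧ (∀ φ : EuclideanSpace ℝ (Fin 3) → EuclideanSpace ℝ (Fin 3), Literature.Analysis.FunctionSpaces.IsTestFunctionOn ⟨{x : EuclideanSpace ℝ (Fin 3) | x ≠ 0}, isOpen_ne⟩ φ → ∫ x, (inner ℝ (V x) (fderiv ℝ φ x (V x)) + P x * Literature.Analysis.FluidPDE.VectorCalculus.divergence φ x) = 0) ∧ (∀ θ : EuclideanSpace ℝ (Fin 3) → ℝ, Literature.Analysis.FunctionSpaces.IsTestFunctionOn ⟨{x : EuclideanSpace ℝ (Fin 3) | x ≠ 0}, isOpen_ne⟩ θ → ∫ x, inner ℝ (V x) (gradient θ x) = 0) ∧ (∀ η : EuclideanSpace ℝ (Fin 3) → ℝ, Literature.Analysis.FunctionSpaces.IsTestFunctionOn ⟨{x : EuclideanSpace ℝ (Fin 3) | x ≠ 0}, isOpen_ne⟩ η → ∫ x, (‖V x‖ ^ 2 / 2 + P x) * inner ℝ (V x) (gradient η x) = 0) ∧ (∀ᵐ x ∂MeasureTheory.volume, ‖V x‖ ^ 2 / 2 + P x ≤ 0) ∧ (∃ M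 : ℝ, ∀ᵐ x ∂(MeasureTheory.volume.restrict {x : EuclideanSpace ℝ (Fin 3) | 1 < ‖x‖ ∧ ‖x‖ < lam}), -M ≤ ‖V x‖ ^ 2 / 2 + P x) ∧ MeasureTheory.IntegrableOn (fun x => (‖V x‖ ^ 2 / 2 + P x) * (inner ℝ (V x) x / ‖x‖ ^ 2)) {x : EuclideanSpace ℝ (Fin 3) | 1 < ‖x‖ ∧ ‖x‖ < lam} MeasureTheory.volume ∧ (∫ x in {x : EuclideanSpace ℝ (Fin 3) | 1 < ‖x‖ ∧ ‖x‖ < lam}, (‖V x‖ ^ 2 / 2 + P x) * (inner ℝ (V x) x / ‖x‖ ^ 2)) < 0) → Summit.AnomalousDissipation.AnomalousDissipation.Theses.PointSink.PointFluxCone := by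
  rintro ⟨lam, V, P, hlam, hV, hVss, hPss, hV2, hPloc, _hV3, _hP32, hEuler, hDiv, _hEnergy, _hSuction,
    _hHead, hFluxInt, hFluxNeg⟩
  exact ⟨lam, V, P, hlam, hV, hVss, hPss, hV2, hPloc, hEuler, hDiv, hFluxInt, hFluxNeg.ne⟩

end Summit.AnomalousDissipation.AnomalousDissipation.Theorems

end
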